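import Literature.Probability.Percolation.TriUQuad
import HarnessLib

/-!
# The inner arc of the U-shaped half-annulus: parametrisation and the two sides of a tip

Topic `Literature/Probability/Percolation`; family `crit-perc`, statement **crit-perc.S16**
(`Literature.Probability.Percolation.triTheta_exponent`). Geometric input of the fence step of
Kesten's arm separation (P. Nolin, EJP 13 (2008), §4.4, proof of Lemma 15 [arXiv 0711.4948:
Lemma 14]) in the U-shaped half-plane region `U_{k,N}` of `TriUQuad.lean`: the **inner arc**
`uL k N` (the sites of `U_{k,N}` adjacent to the inner half-box) is the lattice path
`(-k,0) → (-k,k) → (k-1,k) → (k,k-1) → (k,0)` (`mem_uL_iff`, `arcPt`, `uHt`), and for a crossing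
`S ∋ l` of the quad `uQuad k N` from the arc to the outer boundary **meeting the arc only at its
tip `l`** (as the canonical lowest crossings of `TriQuadProtection.lean` do):

* `exists_pathIn_arc_lt` — every arc site before the tip (`uHt < uHt l`) is joined to the left
  real segment `uB` by a path of `U ∖ S` (along the arc): it lies *below* the crossing;
* `not_joined_uB_of_gt` — no arc site after the tip (`uHt > uHt l`) is joined to `uB` off `S`:
  such a path, continued along the arc to `(k, 0) ∈ uT`, would be a `B–T` path of `U ∖ S`,
  contradicting the crossing property of the quad (`TriQuad.meet` for `uQuad`). This is the
  planar "cut" property of the tip (cf. `JDomain.CutProp` of `TriLowestCrossing.lean` for the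
  trapezoid), obtained here without any padding argument.

## References

* P. Nolin, Near-critical percolation in two dimensions, *Electron. J. Probab.* 13 (2008), §4.4,
  proof of Lemma 15 [arXiv 0711.4948: Lemma 14]; §4.6 (the regions `B_{j,σ}(k,N)`) [Nolin2008].
* H. Kesten, *Percolation theory for mathematicians* (1982), §2.3 (lowest crossings cut the
  domain) [KestenPTM1982].

## Mathlib / tree

Tree: `uL`, `uR`, `uB`, `uT`, `uSites`, `uInner`, `mem_coe_uSites`, `mem_uInner`, `uQuad`,
`uQuad_meet` (`TriUQuad.lean`), `triGraph_adj_cases` (`TriCrossingsMeet.lean`),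
`triGraph_adj_up`, `triGraph_adj_right`, `site_eq_vec` (`HalfPlaneTwoArmPoint.lean`),
`triGraph_adj_add_triDiag` (`TriHexLemma.lean`), `PathIn`.
-/

noncomputable section

open Set

namespace Literature.Probability.Percolation

open LatticeModels

variable {k N : ℕ}

/-! ### The inner arc in coordinates -/

/-- The diagonal step `(a, r) ∼ (a + 1, r - 1)` of `𝕋`. [folklore] -/
theorem triGraph_adj_diag (a r : ℤ) : triGraph.Adj (![a, r] : Site 2) ![a + 1, r - 1] := by
  convert triGraph_adj_add_triDiag (![a, r] : Site 2) using 1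
  ext i; fin_cases i <;> simp [LatticeModels.triDiag, sub_eq_add_neg]

/-- **The inner arc in coordinates**: `uL k N` consists of the left column `{-k} × [0, k]`, the
top row `[-k, k-1] × {k}` and the right column `{k} × [0, k-1]` (`1 ≤ k`, `k + 1 ≤ N`). [cite: Nolin2008, §4.6] -/
theorem mem_uL_iff (hk : 1 ≤ k) (hkN : k + 1 ≤ N) {z : Site 2} :
    z ∈ uL k N ↔ (z 0 = -(k : ℤ) ∧ 0 ≤ z 1 ∧ z 1 ≤ k) ∨ (z 1 = k ∧ -(k : ℤ) ≤ z 0 ∧ z 0 ≤ k - 1) ∨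
      (z 0 = k ∧ 0 ≤ z 1 ∧ z 1 ≤ k - 1) := by
  have hk' : (1 : ℤ) ≤ k := by exact_mod_cast hk
  have hkN' : (k : ℤ) + 1 ≤ N := by exact_mod_cast hkN
  constructor
  · rintro ⟨hz, w, hw, hwz⟩
    rw [mem_coe_uSites, mem_uInner] at hz
    rw [mem_uInner] at hw
    have := triGraph_adj_cases hwz
    omega
  · intro h
    have hzU : z ∈ (↑(uSites k N) : Set (Site 2)) := by
      rw [mem_coe_uSites, mem_uInner]; omega
    refine ⟨hzU, ?_⟩
    rw [site_eq_vec z]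
    rcases h with ⟨h0, h1, h2⟩ | ⟨h1, h0, h2⟩ | ⟨h0, h1, h2⟩
    · by_cases ht : z 1 ≤ k - 1
      · refine ⟨![z 0 + 1, z 1], ?_, (triGraph_adj_right (z 0) (z 1)).symm⟩
        rw [mem_uInner]; simp; omega
      · refine ⟨![z 0 + 1, z 1 - 1], ?_, (triGraph_adj_diag (z 0) (z 1)).symm⟩
        rw [mem_uInner]; simp; omega
    · by_cases hx : z 0 ≤ k - 2
      · refine ⟨![z 0 + 1, z 1 - 1], ?_, (triGraph_adj_diag (z 0) (z 1)).symm⟩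
        rw [mem_uInner]; simp; omega
      · refine ⟨![z 0, z 1 - 1], ?_, ?_⟩
        · rw [mem_uInner]; simp; omega
        · convert triGraph_adj_up (z 0) (z 1 - 1) using 2; ring
    · refine ⟨![z 0 - 1, z 1], ?_, ?_⟩
      · rw [mem_uInner]; simp; omega
      · convert triGraph_adj_right (z 0 - 1) (z 1) using 2; ring

/-- **The arc parameter** ("height" along the arc from `(-k, 0)` to `(k, 0)`): `z₁` on the left
column, `2k + z₀` on the top row, `4k - 1 - z₁` on the right column. [folklore] -/
def uHt (k : ℕ) (z : Site 2) : ℤ :=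
  if z 0 = -(k : ℤ) then z 1 else if z 1 = k then 2 * k + z 0 else 4 * k - 1 - z 1

/-- **The arc parametrisation**: the site of parameter `m ∈ [0, 4k - 1]`. [folklore] -/
def arcPt (k : ℕ) (m : ℤ) : Site 2 :=
  if m ≤ k then ![-(k : ℤ), m] else if m ≤ 3 * k - 1 then ![m - 2 * k, k] else ![(k : ℤ), 4 * k - 1 - m]

/-- The arc point on the left column. [folklore] -/
theorem arcPt_of_le {m : ℤ} (h : m ≤ k) : arcPt k m = ![-(k : ℤ), m] := by simp [arcPt, h]

/-- The arc point on the top row. [folklore] -/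
theorem arcPt_of_mid {m : ℤ} (h1 : (k : ℤ) < m) (h2 : m ≤ 3 * k - 1) : arcPt k m = ![m - 2 * k, (k : ℤ)] := by
  simp [arcPt, not_le.2 h1, h2]

/-- The arc point on the right column. [folklore] -/
theorem arcPt_of_gt (hk : 1 ≤ k) {m : ℤ} (h : 3 * (k : ℤ) - 1 < m) : arcPt k m = ![(k : ℤ), 4 * k - 1 - m] := by
  have hk' : (1 : ℤ) ≤ k := by exact_mod_cast hk
  have h1 : ¬ m ≤ k := by omega
  have h2 : ¬ m ≤ 3 * k - 1 := by omega
  simp [arcPt, h1, h2]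

/-- Arc points lie on the arc. [folklore] -/
theorem arcPt_mem_uL (hk : 1 ≤ k) (hkN : k + 1 ≤ N) {m : ℤ} (hm0 : 0 ≤ m) (hm : m ≤ 4 * k - 1) :
    arcPt k m ∈ uL k N := by
  rw [mem_uL_iff hk hkN]
  have hk' : (1 : ℤ) ≤ k := by exact_mod_cast hk
  by_cases h1 : m ≤ k
  · rw [arcPt_of_le h1]; simp; omega
  · by_cases h2 : m ≤ 3 * k - 1
    · rw [arcPt_of_mid (not_le.1 h1) h2]; simp; omega
    · rw [arcPt_of_gt hk (not_le.1 h2)]; simp; omega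

/-- The parameter of an arc point. [folklore] -/
theorem uHt_arcPt (hk : 1 ≤ k) (m : ℤ) : uHt k (arcPt k m) = m := by
  have hk' : (1 : ℤ) ≤ k := by exact_mod_cast hk
  unfold uHt
  by_cases h1 : m ≤ k
  · rw [arcPt_of_le h1]; simp
  · by_cases h2 : m ≤ 3 * k - 1
    · rw [arcPt_of_mid (not_le.1 h1) h2]
      have h3 : m - 2 * (k : ℤ) ≠ -(k : ℤ) := by omega
      simp [h3]
    · rw [arcPt_of_gt hk (not_le.1 h2)]
      have h3 : (k : ℤ) ≠ -(k : ℤ) := by omega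
      have h4 : 4 * (k : ℤ) - 1 - m ≠ k := by omega
      simp [h3, h4]

/-- Every arc site is the arc point of its parameter, which lies in `[0, 4k - 1]`. [folklore] -/
theorem arcPt_uHt (hk : 1 ≤ k) (hkN : k + 1 ≤ N) {z : Site 2} (hz : z ∈ uL k N) :
    arcPt k (uHt k z) = z ∧ 0 ≤ uHt k z ∧ uHt k z ≤ 4 * k - 1 := by
  rw [mem_uL_iff hk hkN] at hz
  have hk' : (1 : ℤ) ≤ k := by exact_mod_cast hk
  unfold uHt
  rcases hz with ⟨h0, h1, h2⟩ | ⟨h1, h0, h2⟩ | ⟨h0, h1, h2⟩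
  · simp only [h0, if_true]
    exact ⟨by rw [arcPt_of_le h2, site_eq_vec z, h0]; simp, h1, by omega⟩
  · by_cases hx : z 0 = -(k : ℤ)
    · simp only [hx, if_true]
      exact ⟨by rw [arcPt_of_le (le_of_eq h1), site_eq_vec z, hx, h1]; simp, by omega, by omega⟩
    · simp only [hx, if_false, h1, if_true]
      refine ⟨?_, by omega, by omega⟩
      rw [arcPt_of_mid (by omega) (by omega), site_eq_vec z, h1]
      congr 1; simp
  · have hx : z 0 ≠ -(k : ℤ) := by omega
    have hy : z 1 ≠ (k : ℤ) := by omega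
    simp only [hx, if_false, hy]
    refine ⟨?_, by omega, by omega⟩
    rw [arcPt_of_gt hk (by omega), site_eq_vec z, h0]
    congr 1; simp

/-- Consecutive arc points are adjacent. [folklore] -/
theorem arcPt_adj (hk : 1 ≤ k) {m : ℤ} (hm0 : 0 ≤ m) (hm : m + 1 ≤ 4 * k - 1) :
    triGraph.Adj (arcPt k m) (arcPt k (m + 1)) := by
  have hk' : (1 : ℤ) ≤ k := by exact_mod_cast hk
  by_cases h1 : m + 1 ≤ k
  · rw [arcPt_of_le (by omega : m ≤ k), arcPt_of_le h1]; exact triGraph_adj_up _ _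
  · by_cases h2 : m = k
    · rw [arcPt_of_le (by omega : m ≤ k), arcPt_of_mid (by omega) (by omega)]
      subst h2
      have e : (k : ℤ) + 1 - 2 * k = -(k : ℤ) + 1 := by ring
      rw [e]; exact triGraph_adj_right _ _
    · by_cases h3 : m + 1 ≤ 3 * k - 1
      · rw [arcPt_of_mid (by omega) (by omega), arcPt_of_mid (by omega) h3]
        have e : m + 1 - 2 * (k : ℤ) = m - 2 * k + 1 := by ring
        rw [e]; exact triGraph_adj_right _ _
      · by_cases h4 : m = 3 * k - 1
        · rw [arcPt_of_mid (by omega) (by omega), arcPt_of_gt hk (by omega)]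
          subst h4
          have this := triGraph_adj_diag (3 * (k : ℤ) - 1 - 2 * k) (k : ℤ)
          have e1 : 3 * (k : ℤ) - 1 - 2 * k + 1 = k := by ring
          have e2 : 4 * (k : ℤ) - 1 - (3 * k - 1 + 1) = k - 1 := by ring
          rw [e1] at this
          rw [e2]; exact this
        · rw [arcPt_of_gt hk (by omega), arcPt_of_gt hk (by omega)]
          have this := (triGraph_adj_up (k : ℤ) (4 * k - 1 - (m + 1))).symm
          have e : 4 * (k : ℤ) - 1 - (m + 1) + 1 = 4 * k - 1 - m := by ring
          rw [e] at this
          exact this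

/-- **Paths along the arc**: for `0 ≤ i ≤ j ≤ 4k - 1` the arc points of parameters in `[i, j]`
form a `𝕋`-path from `arcPt i` to `arcPt j`. [folklore] -/
theorem pathIn_arc (hk : 1 ≤ k) {i j : ℤ} (hi : 0 ≤ i) (hij : i ≤ j) (hj : j ≤ 4 * k - 1) :
    PathIn triGraph {z | ∃ m, i ≤ m ∧ m ≤ j ∧ z = arcPt k m} (arcPt k i) (arcPt k j) := by
  obtain ⟨d, rfl⟩ : ∃ d : ℕ, j = i + d := ⟨(j - i).toNat, by omega⟩
  induction d with
  | zero =>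
    simp only [Nat.cast_zero, add_zero]
    exact PathIn.refl (show arcPt k i ∈ {z : Site 2 | ∃ m, i ≤ m ∧ m ≤ i ∧ z = arcPt k m} from
      ⟨i, le_rfl, le_rfl, rfl⟩)
  | succ d ih =>
    have h := ih (by omega) (by omega)
    have step : triGraph.Adj (arcPt k (i + d)) (arcPt k (i + (d + 1 : ℕ))) := by
      have := arcPt_adj hk (m := i + d) (by omega) (by push_cast at hj ⊢; omega)
      convert this using 2; push_cast; ring
    refine (h.mono ?_).tail step ?_
    · rintro z ⟨m, h1, h2, rfl⟩
      exact ⟨m, h1, by push_cast at h2 ⊢; omega, rfl⟩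
    · exact ⟨i + (d + 1 : ℕ), by omega, le_rfl, rfl⟩

/-- The ends of the arc: `arcPt 0 = (-k, 0) ∈ uB` and `arcPt (4k-1) = (k, 0) ∈ uT`. [folklore] -/
theorem arcPt_zero_mem_uB (hkN : k + 1 ≤ N) : arcPt k 0 ∈ uB k N := by
  rw [arcPt_of_le (by exact_mod_cast Nat.zero_le k)]
  refine ⟨by simp, ?_, by simp⟩
  simp; omega

/-- The other end of the arc lies in `uT`. [folklore] -/
theorem arcPt_last_mem_uT (hk : 1 ≤ k) (hkN : k + 1 ≤ N) : arcPt k (4 * k - 1) ∈ uT k N := by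
  have hk' : (1 : ℤ) ≤ k := by exact_mod_cast hk
  rw [arcPt_of_gt hk (by omega)]
  refine ⟨by simp, by simp, ?_⟩
  simp; omega

/-! ### The two sides of the tip of a crossing -/

/-- **Before the tip, the arc lies below the crossing**: if `S ⊆ U` meets the arc only at `l`,
every arc site `z` with `uHt z < uHt l` is joined to `(-k, 0) ∈ uB` by the arc itself, a path of
`U ∖ S`. [cite: Nolin2008, §4.4, proof of Lemma 15 (arXiv 0711.4948: Lemma 14)] -/
theorem exists_pathIn_arc_lt (hk : 1 ≤ k) (hkN : k + 1 ≤ N) {S : Set (Site 2)} {l : Site 2}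
    (honly : ∀ z ∈ S, z ∈ uL k N → z = l) {z : Site 2} (hz : z ∈ uL k N)
    (hlt : uHt k z < uHt k l) :
    ∃ b ∈ uB k N, PathIn triGraph ((↑(uSites k N) : Set (Site 2)) \ S) b z := by
  obtain ⟨hzpt, hz0, hz1⟩ := arcPt_uHt hk hkN hz
  refine ⟨arcPt k 0, arcPt_zero_mem_uB hkN, ?_⟩
  have hp := pathIn_arc hk (i := 0) (j := uHt k z) le_rfl hz0 hz1
  rw [hzpt] at hp
  refine hp.mono ?_
  rintro w ⟨m, hm0, hm1, rfl⟩
  have hwL : arcPt k m ∈ uL k N := arcPt_mem_uL hk hkN hm0 (by omega)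
  refine ⟨hwL.1, fun hwS => ?_⟩
  have := honly _ hwS hwL
  have h2 := uHt_arcPt hk m
  rw [this] at h2
  omega

/-- **After the tip, the arc is not joined to `uB` off the crossing.** Let `S ⊆ U` contain an
arc-to-outer-boundary path of the quad `uQuad k N` and meet the arc only at `l`. Then no arc site
`z` with `uHt z > uHt l` is joined to the left real segment `uB` by a path of `U ∖ S`: continued
along the arc to `(k, 0) ∈ uT` it would give a `B–T` path avoiding the `L–R` path inside `S`,
against `TriQuad.meet`. [cite: Nolin2008, §4.4, proof of Lemma 15 (arXiv 0711.4948: Lemma 14)] [cite: KestenPTM1982, §2.3] -/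
theorem not_joined_uB_of_gt (hk : 1 ≤ k) (hkN : k + 1 ≤ N) {S : Set (Site 2)}
    (hS : S ⊆ ↑(uSites k N)) {l r : Site 2} (hl : l ∈ uL k N) (hr : r ∈ uR k N)
    (hp : PathIn triGraph S l r) (honly : ∀ z ∈ S, z ∈ uL k N → z = l) {z : Site 2} (hz : z ∈ uL k N)
    (hgt : uHt k l < uHt k z) :
    ¬ ∃ b ∈ uB k N, PathIn triGraph ((↑(uSites k N) : Set (Site 2)) \ S) b z := by
  rintro ⟨b, hb, hbz⟩
  have hk' : (1 : ℤ) ≤ k := by exact_mod_cast hk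
  obtain ⟨hzpt, hz0, hz1⟩ := arcPt_uHt hk hkN hz
  -- continue along the arc to `(k, 0)`
  have harc := pathIn_arc hk (i := uHt k z) (j := 4 * k - 1) hz0 hz1 le_rfl
  rw [hzpt] at harc
  have harc' : PathIn triGraph ((↑(uSites k N) : Set (Site 2)) \ S) z (arcPt k (4 * k - 1)) := by
    refine harc.mono ?_
    rintro w ⟨m, hm0, hm1, rfl⟩
    have hwL : arcPt k m ∈ uL k N := arcPt_mem_uL hk hkN (by omega) hm1
    refine ⟨hwL.1, fun hwS => ?_⟩
    have := honly _ hwS hwL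
    have h2 := uHt_arcPt hk m
    rw [this] at h2
    omega
  obtain ⟨w, hwS, hwU⟩ := (uQuad k N hk hkN).meet hS (fun w hw => hw.1) hl hr hp hb
    (arcPt_last_mem_uT hk hkN) (hbz.trans harc')
  exact hwU.2 hwS

end Literature.Probability.Percolation
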